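import Mathlib
import HarnessLib
import Summits.HubbardSuperconductivity.HubbardSuperconductivity.Theorems.ChiralWindowDefsBox

/-!
# Certificate vocabulary: the box part of the numerical hypothesis, ONE BOX AT A TIME (crux `CwKLChiralWindow`, line `Sketch`)

Companion of `Theorems/ChiralWindowDefsBox.lean` (`KLCert.BoxEnclosures`: on every box of a record, uniformly in `μ`, the residual-form
block enclosures E1, E2, E3R, E4 and the node enclosures E5S, E6); crux item stmt-HubbardSuperconductivity-1741.

The certified interval-arithmetic computation of `klCertL.BoxEnclosures` is naturally done box by box, and the boxes are of very different
weight: the two POINT boxes (μ = μ_b and μ = μ_a exactly) carry the end clauses of the crux — box 0 alone is the certified "sign of the chiral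
Kohn–Luttinger coefficient" (E below B1g and B2g at μ_b) — and need no transport in `μ`, while the two interior boxes need uniformity in `μ`.
This file NAMES the per-box statement `KLCert.BoxEnclosureAt c i` (the enclosures of the `i`-th box of the record, vacuous beyond the end of the
list) and proves the bookkeeping lemma `KLCert.boxEnclosures_of_forall : (∀ i < c.boxes.length, c.BoxEnclosureAt i) → c.BoxEnclosures`, so that
each box can be a separately registered stub / computation item and land on its own.
-/

noncomputable section

namespace Summit.HubbardSuperconductivity.HubbardSuperconductivity.Theorems.CwKLChiralWindow

set_option linter.dupNamespace false -- summit = problem name (single-conjunct summit), D-0017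

open MeasureTheory Literature.MathematicalPhysics.QuantumLattice

namespace KLCert

/-- **The enclosures of the `i`-th box of a record** (interface E1, E2, E3R, E4, E5S, E6 on that box, uniformly in `μ ∈ [mulo, muhi]`);
`True` if the record has no `i`-th box. [folklore] -/
def BoxEnclosureAt (c : KLCert) (i : ℕ) : Prop :=
  ∀ bx : KLBox, c.boxes[i]? = some bx → ∀ μ ∈ Set.Icc (bx.mulo : ℝ) (bx.muhi : ℝ),
    (∀ χ : D4Irrep, (bx.blk χ).EnclosureR c.trials μ χ) ∧ bx.NodeEnclosureS c.trials μ

/-- The box part of the numerical hypothesis follows from the per-box statements for all indices below the number of boxes.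
[folklore] -/
theorem boxEnclosures_of_forall : ∀ c : KLCert, (∀ i < c.boxes.length, c.BoxEnclosureAt i) → c.BoxEnclosures := by
  intro c h bx hbx μ hμ
  obtain ⟨i, hi, rfl⟩ := List.getElem_of_mem hbx
  exact h i hi _ (List.getElem?_eq_getElem hi) μ hμ

end KLCert

end Summit.HubbardSuperconductivity.HubbardSuperconductivity.Theorems.CwKLChiralWindow

end
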